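import Summits.BirchSwinnertonDyer.Rank1Residual.X6.RankZeroCertificateDisplay
import Summits.BirchSwinnertonDyer.Rank1Residual.X6.RankZeroCertificateCoverage3A
import Summits.BirchSwinnertonDyer.Rank1Residual.X6.RankZeroCertificateCoverage3B
import Summits.BirchSwinnertonDyer.Rank1Residual.X6.RankZeroCertificateCoverage5
import HarnessLib

/-!
# Class X6 ∧ analytic rank `0` — the COVERAGE DISPLAY: every one of the 734 residue records has a per-pair road of record in the tree

Cell `bsd-print-x6` (D-0131 (2) print tier, key `x6`), typer seat ty3 (gen 2; PLAN v2 §ty3). `coverage = coverage3A ++ coverage3B ++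
coverage5` is ONE kernel list of 734 entries aligned with `PrintCert.allRecords` (`covers_allRecords`, `coverage_labels`): for each
residue pair (Cremona class, `p`) of the leaf X6 ∧ `r_an = 0` (`N < 5·10⁵`) its CANONICAL road of record and the secondary roads
found, as resolved declaration names. COUNTS (`road_counts`): `p = 3` (621): 12 two-engine EXACT `3`-descent rows
(`DescentRecords.checked_x6_rankZero_sha9_desc3`) + 606 two-engine LOWER-BOUND `3`-descent rows (`DescentLowerBoundRecords.checked_X6_sample`
×10, `…checked_X6_beyond_partA` ×296, `…partB` ×295, `…checked_beyond_addendum_g24` ×2, `…g29` ×1, `…checkedS_beyond_addendum_g29` ×2) —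
all 618 with `ord₃ #Ш_an = 2`, each row JOINED IN THE KERNEL to its record by label + a-invariants + `#Ш_an` (`desc3_row_of_mem`) — and
3 Cassels–Tate-free second-`3`-descent theorems `SecondDescent.bsdp3_b1n_<label>''` (the `ord₃ #Ш_an = 4` trio 152330l1, 271726d1,
405130d1); `p ≥ 5` (113): 99 Kurihara offers `Supersingular.bsdp_x6r0_<label>_<p>`, 8 Kurihara-number data rows
`KuriharaRecords.cert_X6_<label>_p<p>` (joined by label + a-invariants + `p`, `atFive_of_mem`), 1 K-Kim theorem
(`KimKurihara.bsdp_cremona15953a1_5`), 3 Kim Tamagawa-defect theorems `bsdp_x6r0tam_<label>_<p>` (145146q1@5, 130798a1@7, 399190l1@7),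
2 visibility theorems `bsdp_x6r0vis_<label>_5` (22678e1, 492414f1). SECONDARY roads (`also_counts`): 17 `kp3OfferOPEN`
(`bsdp_x6r0kp3_<label>`, CONDITIONAL on `Kim2025.thm11_kimShaLength_of_integralPeriod_OPEN`), 6 `secondDescentCT`, 21
`visibilityWitness`, 2 `kimTamDefect`, 1 `visibility`, 1 `kimKurihara`, 1 `kuriharaCert`.

ROAD TABLE (binders verbatim from one representative signature; `W = ⟨…⟩` the record's minimal model; every road also takes
`hGZK : rank_eq_analyticRank_of_analyticRank_le_one`, `hmod : hasEntireLFunction_rat`):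
* `desc3Exact` / `desc3LowerBound` — DATA (`Supersingular/X678DescentRecords.lean`, `…/DescentLowerBoundRecords{,X6A,X6B,G24,G29}.lean`:
  two independent `3`-descent implementations, `dim_𝔽₃ Sel^(3)(E/ℚ) = 2` resp. `≥ 2`, same `𝔽₃`-subspace); generic consumer
  `Supersingular.X6.bsdp_rankZero_of_casselsTate_of_selmerGroup_ne_bot (hCT : exists_casselsTate_pairing) (hW : sha_dvd_analyticSha) hGZK hmod
  (hp : p ≠ 2) (hX : ClassX6 W p) (hr : r_an = 0) (hq hv : ord_p #Ш_an ≤ 2) (hSel : W.selmerGroup p ≠ ⊥)`; the 12 exact rows also have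
  Cassels–Tate-free per-pair consumers on the Theorems side (`Theorems/PrintX6DescentCertificateRoadSelmerNineDisplay.lean`,
  `X6.bsdp3_sel9exact_<label>`; K3 `Theorems/SignedLowerHalvesKobayashiLowerHalfSemistableSelmerNineRecords.lean`) — not imported here (route cone).
* `secondDescent` — THEOREM `SecondDescent.bsdp3_b1n_<label>'' (hW : sha_dvd_analyticSha) hGZK hmod (hWm : W = ⟨…⟩) (hr : r_an = 0)
  (h1 h2 : 3 • cᵢ = 0) (hc₁ : c₁ ≠ 0) (hind : c₂ ∉ ℤ∙c₁) (hd₁ hd₂ : 3 • dᵢ = cᵢ) (hq hv : ord₃ #Ш_an ≤ 4) : BSDp W 3` (Creutz second descent,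
  `NonemptyCasselsTateFree.lean`; K3's congruence-donor closures of the same trio live on the Theorems side, not imported).
* `kuriharaOffer` — THEOREM `Supersingular.bsdp_x6r0_<label>_<p> (hKim : Kim2022_rankZero_padicValRat_sha_of_kuriharaNumber_ne_zero)
  (hϖ : realPeriodRat_eq_unit_mul_plusPeriod) hGZK hmod (hW : W = ⟨…⟩) (hr0 : r_an = 0) (htam : ¬ p ∣ ∏c) (f, hf : IsNewformOf W f)
  [(hcyc) on the `Cyc` files] (hballL : the engine's L-value enclosure) : BSDp W p` (`X6KuriharaOfferRecords01–11`, `…Cyc01–03`; each offer has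
  packaging variants in `X6KuriharaOffer{Ran,RanL1,Tam,Cyc}Cert*` — not listed).
* `kuriharaCert` — DATA `KuriharaRecords.cert_X6_<label>_p<p> : KuriharaCertificates.Certified [rows]` (`X6KuriharaRecords{,BW}.lean`, two
  implementations of `δ̃_n mod p`); generic consumer `Supersingular.X6.bsdp_of_kim_rankZero_of_kuriharaNumber_ne_zero (hKim) (hϖ) hGZK hmod
  (hp : 5 ≤ p) (hX : ClassX6 W p) (hr : r_an = 0) (htam : ¬ p ∣ ∏c) (f hf) (n, hn, hcyc, ψ, hψ) (hδ : kuriharaNumber f p n ψ ≠ 0)` (`X6KuriharaRoute.lean`).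
* `kimKurihara` — THEOREM `KimKurihara.bsdp_cremona15953a1_5 (hKim) (hϖ) hGZK hmod (hran : r_an = 0) (htam) (f hf) … : BSDp cremona15953a1 5`.
* `kimTamDefect` — THEOREM `Supersingular.bsdp_x6r0tam_<label>_<p> (hKimL : Kim2026.rankZero_le_padicValNat_sha_of_kuriharaNumber_ne_zero)
  (h48 : PerrinRiou2003.prop48_padicValRat_bsd_rank_zero_le) hGZK hmod (hW : W = ⟨…⟩) (hr0) (hkt : Tamagawa defect) (hc : p ∤ Manin constant)
  (hper : period unit) (hψᵢ, hδ : kuriharaNumber … ≠ 0) : BSDp W p` (`X6KimTamDefectRecords{,B,C}`; variants `…LValues`, `X67KimTamDefectRecordsRanCert`).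
* `visibility` — THEOREM `Supersingular.bsdp_x6r0vis_<label>_5 (hCT : exists_casselsTate_pairing) (hW : sha_dvd_analyticSha) hGZK hmod
  (hU hU2 : Silverman1994_thmV53[_corV54]_tateUniformisation) (hF44 : thm44_selmerLocalKer_iff_of_nonsplit_good | hF13 : thm132_fiveCongruent_hessePencil)
  (hWeq hFeq : literal models of E and the rank-2 congruent curve F) (hr0) (hq hv) (hrank : 2 ≤ rank F) (point counts) : BSDp W 5`
  (`X6VisibilityTamDefectRecords{,B}`; variant `X6Visibility5Records01`, L-value packagings `X6Visibility*L1Cert*` not listed).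
* secondary `kp3OfferOPEN` — `Supersingular.bsdp_x6r0kp3_<label> (hK25s : Kim2025.thm11_kimShaLength_of_integralPeriod_OPEN) (hW : sha_dvd_analyticSha) …
  : BSDp W 3` (announced, unrefereed input: never a road of record here); `secondDescentCT` — `bsdp3_b1n_<label>`/`'` with `hCT`;
  `visibilityWitness` — `bsdp_x6r0visw[b]_<label>_5` / `…visw7[b]_…_7` / `…vis7_…_7` (`hCT hW hGZK hmod hMR …`).

What the kernel certifies here: the alignment and counts; for the 626 DATA-road records that the pointed row of the named tree
theorem IS the record's curve (same label, same minimal model) with the same `#Ш_an` resp. `p` — an independent cross-check of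
ty3's two-engine table against the b2b/K3 cells' two-engine tables (0 mismatches); for the 108 THEOREM-road records that the named
declarations exist (name literals resolved at elaboration). What it does NOT certify: that a named theorem's binders are
discharged (they are not: named facts + certificate lines), nor any analytic claim. Independent re-derivation of p4-g1's census
join (evidence `p4-g1-A6-census-complete.md` on items 20276/20285): same verdict, 734/734.

HONEST FRAMING: this is a DISPLAY (bookkeeping in the kernel). It books nothing, moves no PARTITION cell, proves no class
theorem and asserts nothing about any curve beyond (a) what the cited tree files already state and (b) the JOIN itself. Every
per-pair theorem it names is CONDITIONAL on the binders printed in that theorem's own signature (named published facts by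
name + the pair's certificate / claim lines; the `kp3OfferOPEN` road is conditional on an announced, unrefereed result and is
listed as a secondary road only); every data row it points to is a two-engine computation rechecked for SHAPE in its own file.
The class-wide statement (route PrintX6 cruxes `EisensteinHalfFiveLe` / `EisensteinHalfAtThree`) is untouched.

References: Cremona's tables [Cremona2006]; [Creutz2014]; [Kim2022StructureSelmer] Thm. 1.9 (6); [Wuthrich2014] Prop. 21; [SilvermanAEC2009] X.4.
-/

set_option autoImplicit false

noncomputable section

namespace Summit.BirchSwinnertonDyer.Rank1Residual.X6.PrintCert

/-- The coverage display: one entry per residue record, in the order of `allRecords`. [cite: Cremona2006, Table 1 (curve data by Cremona label)] -/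
def coverage : List Cover := coverage3A ++ coverage3B ++ coverage5

/-- Every entry rechecks against its record of `allRecords`. [folklore] -/
theorem covers_allRecords : covers allRecords coverage = true := by
  have h := covers_append (covers_append covers_coverage3A covers_coverage3B) covers_coverage5
  simpa only [allRecords, coverage, List.append_assoc] using h

/-- The display lists exactly the labels of `allRecords`, in order. [folklore] -/
theorem coverage_labels : coverage.map Cover.label = allRecords.map Record.label :=
  labels_of_covers covers_allRecords

/-- Canonical road counts: 12 exact + 606 lower-bound `3`-descent rows, 3 second-descent theorems, 99 Kurihara offers, 8 Kurihara rows,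
1 K-Kim theorem, 3 Tamagawa-defect theorems, 2 visibility theorems — 734 in all, 626 data roads and 108 theorem roads. [folklore] -/
theorem road_counts : coverage.length = 734 ∧
    (coverage.filter fun c => c.road = .desc3Exact).length = 12 ∧
    (coverage.filter fun c => c.road = .desc3LowerBound).length = 606 ∧
    (coverage.filter fun c => c.road = .secondDescent).length = 3 ∧
    (coverage.filter fun c => c.road = .kuriharaOffer).length = 99 ∧
    (coverage.filter fun c => c.road = .kuriharaCert).length = 8 ∧
    (coverage.filter fun c => c.road = .kimKurihara).length = 1 ∧
    (coverage.filter fun c => c.road = .kimTamDefect).length = 3 ∧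
    (coverage.filter fun c => c.road = .visibility).length = 2 ∧
    (coverage.filter fun c => c.src.isSome).length = 626 := by
  decide +kernel

/-- Secondary road counts: 17 `kp3OfferOPEN`, 6 `secondDescentCT`, 21 `visibilityWitness`, 2 `kimTamDefect`, 1 `visibility`,
1 `kimKurihara`, 1 `kuriharaCert`; 30 records carry a secondary road. [folklore] -/
theorem also_counts : ((coverage.flatMap Cover.also).filter fun a => a.1 = .kp3OfferOPEN).length = 17 ∧
    ((coverage.flatMap Cover.also).filter fun a => a.1 = .secondDescentCT).length = 6 ∧
    ((coverage.flatMap Cover.also).filter fun a => a.1 = .visibilityWitness).length = 21 ∧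
    ((coverage.flatMap Cover.also).filter fun a => a.1 = .kimTamDefect).length = 2 ∧
    ((coverage.flatMap Cover.also).filter fun a => a.1 = .visibility).length = 1 ∧
    ((coverage.flatMap Cover.also).filter fun a => a.1 = .kimKurihara).length = 1 ∧
    ((coverage.flatMap Cover.also).filter fun a => a.1 = .kuriharaCert).length = 1 ∧
    (coverage.filter fun c => c.also ≠ []).length = 30 := by
  decide +kernel

/-- **Every residue record has a road of record**: an entry of the display with its label and prime that rechecks against it. [folklore] -/
theorem exists_cover_of_mem (r : Record) (hr : r ∈ allRecords) :
    ∃ c ∈ coverage, c.label = r.label ∧ c.p = r.p ∧ c.check r = true := by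
  obtain ⟨c, hc, h⟩ := exists_check_of_covers covers_allRecords r hr
  exact ⟨c, hc, (Cover.label_eq_of_check h).1, (Cover.label_eq_of_check h).2, h⟩

/-- **The `3`-descent join**: every residue record at `p = 3` with `ord₃ #Ш_an = 2` (618 of them) IS — same label, same minimal
model, same `#Ш_an` — a row of one of the tree's two-engine `3`-descent tables (`Src.rows`, read off the data theorems
`DescentRecords.checked_x6_rankZero_sha9_desc3` / `DescentLowerBoundRecords.checked_X6_*` / `…_addendum_g24/g29`). [folklore] -/
theorem desc3_row_of_mem (r : Record) (hr : r ∈ allRecords) (hp : r.p = 3) (h2 : r.ordpSha = 2) :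
    ∃ s : Src, s.isDesc3 = true ∧ (r.label, r.ainvs, r.shaAn) ∈ s.rows := by
  obtain ⟨c, _, h⟩ := exists_check_of_covers covers_allRecords r hr
  obtain ⟨s, i, _, hs, _, hrow⟩ := Cover.desc3Row_of_check h (Cover.isDesc3_of_check h hp h2)
  exact ⟨s, hs, Src.mem_rows_of_getElem? hrow⟩

/-- At `p = 3` with `ord₃ #Ш_an ≠ 2` (the three `ord₃ #Ш_an = 4` records) the road of record is the second-descent theorem. [folklore] -/
theorem secondDescent_of_mem (r : Record) (hr : r ∈ allRecords) (hp : r.p = 3) (h2 : r.ordpSha ≠ 2) :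
    ∃ c ∈ coverage, c.label = r.label ∧ c.road = .secondDescent := by
  obtain ⟨c, hc, h⟩ := exists_check_of_covers covers_allRecords r hr
  exact ⟨c, hc, (Cover.label_eq_of_check h).1, Cover.secondDescent_of_check h hp h2⟩

/-- At `p ≥ 5` the road of record is one of the five `p ≥ 5` roads; when it is the Kurihara data row, that row IS the record's
curve at the record's prime. [folklore] -/
theorem atFive_of_mem (r : Record) (hr : r ∈ allRecords) (hp : r.p ≠ 3) :
    ∃ c ∈ coverage, c.label = r.label ∧ c.road.atFive = true ∧
      (c.road = .kuriharaCert → ∃ s : Src, (r.label, r.ainvs, r.p) ∈ s.rows) := by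
  obtain ⟨c, hc, h⟩ := exists_check_of_covers covers_allRecords r hr
  refine ⟨c, hc, (Cover.label_eq_of_check h).1, Cover.atFive_of_check h hp, fun hk => ?_⟩
  obtain ⟨s, i, _, _, hrow⟩ := Cover.kuriharaRow_of_check h hk
  exact ⟨s, Src.mem_rows_of_getElem? hrow⟩

end Summit.BirchSwinnertonDyer.Rank1Residual.X6.PrintCert

end
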